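import Summits.CriticalPhenomena.PercolationContinuityZ3.Theorems.PercNearOneGluingNoHeavyQuantFarSunTKThree
import HarnessLib

/-!
# FAR beyond trees: `HairyCycle.SunFAR K 1` for EVERY `K ≥ 2`, and the layer-one far-relay row on EVERY hairy cycle and ring

builds on p205010 (kernel theorem, internal audit signed; external expert review pending)

Support file (`--supports stmt-CriticalPhenomena-4575`), seat `prim-cert-1` (gen 23); memo `prim-cert-1/FROM-prim-cert-1-g23-SUNFAR-ALL-K.md`.
STANDARD AXIOMS (second submission; the first combined `sunFAR_one_of_four_le` with gen 18's `native_decide` certificates for `K ≤ 7`):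
`K ≥ 4` is the closed-form certificate `T_K` (`…QuantFarSunTKFinal`), `K = 3` the tabulated law-level certificate `F₃` with a kernel-`decide`d
core inequality and `K = 2` vacuous (`…QuantFarSunTKThree`).
* **`HairyCycle.sunFAR_one`** — `SunFAR K 1` for every `K ≥ 2`.
* **`HairyCycle.farRelayRow_layerOne_hairyCycle` / `HairyCycle.farRelayRow_layerOne_ring`** — the body of `Quant.FarRelayRow` at layer
  one (`j = 1`) on EVERY hairy cycle (`IsHairyCycle`) and EVERY ring (`IsHairyCycleD`): all lengths, all weights, any number of relays
  (gen 20's bridges `farRelayRow_hairyCycle_of_sunFAR` / `farRelayRow_ring_of_sunFAR`).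
No sorries; standard axioms (no `native_decide`).  [this work]; the row itself: [cite: KozmaNitzan2024, Conjecture 3 (p. 15)] (context).
-/

noncomputable section

namespace Summit.CriticalPhenomena.PercolationContinuityZ3.Theorems.HairyCycle

open MeasureTheory
open Literature.Probability.LatticeModels
open Literature.Probability.Percolation
open scoped Classical

/-- **`SunFAR K 1` for every `K ≥ 2`** (`K ≥ 4`: the law-level certificate `T_K`; `K = 3`: the tabulated certificate `F₃`; `K = 2`:
vacuous) — standard axioms. [this work] -/
theorem sunFAR_one {K : ℕ} (hK : 2 ≤ K) : SunFAR K 1 := by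
  rcases Nat.lt_or_ge K 4 with h4 | h4
  · interval_cases K
    · exact sunFAR_one_two
    · exact sunFAR_one_three
  · exact sunFAR_one_of_four_le h4

variable {n : ℕ} {L : ℕ} {cyc : ℕ → Fin n} {K : ℕ} {base : ℕ → ℕ} {tip : ℕ → Fin n}

/-- With at most one relay the layer-one mean hypothesis `2 < Σ_k P(c₀ ↔ t_k)` cannot hold. [this work] -/
theorem two_le_of_hEN (w : Sym2 (Fin n) → unitInterval)
    (hEN : (2 * (1 : ℕ) : ℝ) < ∑ a ∈ (Finset.range K).image tip, (prodBernoulli w).real (openConn (cyc 0) a)) : 2 ≤ K := by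
  by_contra hK
  have hcard : ((Finset.range K).image tip).card ≤ 1 :=
    le_trans Finset.card_image_le (by rw [Finset.card_range]; omega)
  have hle : ∑ a ∈ (Finset.range K).image tip, (prodBernoulli w).real (openConn (cyc 0) a) ≤ ((Finset.range K).image tip).card := by
    have := Finset.sum_le_sum (s := (Finset.range K).image tip) (f := fun a => (prodBernoulli w).real (openConn (cyc 0) a))
      (g := fun _ => (1 : ℝ)) (fun a _ => measureReal_le_one)
    simpa using this
  have : (((Finset.range K).image tip).card : ℝ) ≤ 1 := by exact_mod_cast hcard
  push_cast at hEN
  linarith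

/-- **FAR at layer one on EVERY hairy cycle** (`IsHairyCycle L cyc K base tip`, any weight function supported on the cycle and hair pairs):
`2 < Σ_k P(c₀ ↔ t_k)` and `P(c₀ ↮ t_k) ≤ t` for all `k` imply `P(#{k : c₀ ↔ t_k} ≤ 1) ≤ t`. [this work] -/
theorem farRelayRow_layerOne_hairyCycle (H : IsHairyCycle L cyc K base tip) (w : Sym2 (Fin n) → unitInterval)
    (hsupp : ∀ e : Sym2 (Fin n), ¬ e.IsDiag → w e ≠ 0 →
      (∃ i, i < L ∧ e = cycE L cyc i) ∨ (∃ k, k < K ∧ e = hairE cyc base tip k))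
    (t : ℝ)
    (hEN : (2 * (1 : ℕ) : ℝ) < ∑ a ∈ (Finset.range K).image tip, (prodBernoulli w).real (openConn (cyc 0) a))
    (hcut : ∀ a ∈ (Finset.range K).image tip, (prodBernoulli w).real (openConn (cyc 0) a)ᶜ ≤ t) :
    (prodBernoulli w).real {ω : BondConfig (Fin n) |
      (((Finset.range K).image tip).filter fun a => ω ∈ openConn (cyc 0) a).card ≤ 1} ≤ t :=
  farRelayRow_hairyCycle_of_sunFAR H (sunFAR_one (two_le_of_hEN w hEN)) w hsupp t hEN hcut

/-- **FAR at layer one on EVERY ring** (`IsHairyCycleD`: relays at cycle vertices and/or on pendant hairs). [this work] -/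
theorem farRelayRow_layerOne_ring (H : IsHairyCycleD L cyc K base tip) (w : Sym2 (Fin n) → unitInterval)
    (hsupp : ∀ e : Sym2 (Fin n), ¬ e.IsDiag → w e ≠ 0 →
      (∃ i, i < L ∧ e = cycE L cyc i) ∨ (∃ k, k < K ∧ e = hairE cyc base tip k))
    (t : ℝ)
    (hEN : (2 * (1 : ℕ) : ℝ) < ∑ a ∈ (Finset.range K).image tip, (prodBernoulli w).real (openConn (cyc 0) a))
    (hcut : ∀ a ∈ (Finset.range K).image tip, (prodBernoulli w).real (openConn (cyc 0) a)ᶜ ≤ t) :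
    (prodBernoulli w).real {ω : BondConfig (Fin n) |
      (((Finset.range K).image tip).filter fun a => ω ∈ openConn (cyc 0) a).card ≤ 1} ≤ t :=
  farRelayRow_ring_of_sunFAR H (sunFAR_one (two_le_of_hEN w hEN)) w hsupp t hEN hcut

end Summit.CriticalPhenomena.PercolationContinuityZ3.Theorems.HairyCycle

end
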